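import Mathlib
import Summits.PneNP.PneNP.Theorems.Nc03AvoidResidualCoreReductionFrame
import Summits.PneNP.PneNP.Theorems.Nc03AvoidResidualCoreReductionNPN
import Summits.PneNP.PneNP.Theorems.Nc03AvoidResidualCoreReductionParse

/-!
# Route Nc03AvoidResidualCore, item `ResidualCoreReduction` — the solver, II: buckets, relaxation, scatter

Helper file for `stmt-PneNP-20227` (sequel of `…ReductionParse`; cell pnp-ideate). The list-level
("program") versions of the reduction steps and their agreement with the mathematical objects of
`…ReductionFrame` / `…ReductionNPN`:

* `npnB` — the NPN datum `(class, perm, mask, neg)` of a record's table byte (`= npnOf` of the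
  output's table); `bucket recs c` — the outputs of class `c` with their indices; `pureTriple` —
  the variables of the relaxed pure output (`6v + 2r + s`, the copy `cp`); `pureOf ri c : PRaw` —
  the raw form `(6n, M', triples)` of the relaxed bucket; `rawOf J` — the raw form of a pure
  instance; `scatter` — negations put back and the pattern spread over all `m` outputs.
* `Jb I c` — the relaxed bucket as a `LocalMap 3 (6n) M'` (`relax (restrict I ι) π σ (rep c)`),
  with `rawOf (Jb I c) = pureOf (toRaw I) c` (`rawOf_Jb`), and the GLUE THEOREM `scatter_not_mem`:
  a list `y'` of length `M'` read as a pattern outside the range of `Jb I c` scatters to a list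
  read as a pattern outside the range of `I` (via `not_mem_range_of_bucket` and the NPN normal
  form). So a class solver only ever sees raw pure instances `rawOf J`.
-/

set_option linter.dupNamespace false -- `Summit.PneNP.PneNP.…`: summit = sub-problem name (D-0017 single-conjunct layout)

namespace Summit.PneNP.PneNP.Theorems.Nc03Reduction

open Literature.Computability.Complexity

/-! ## Program-level definitions -/

/-- A raw pure instance: `N`, `M`, and the variable triples of the outputs. -/
abbrev PRaw := ℕ × ℕ × List (ℕ × ℕ × ℕ)

/-- The raw form of a (pure) instance. -/
def rawOf {N M : ℕ} (J : LocalMap 3 N M) : PRaw :=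
  (N, M, List.ofFn fun p => ((J.vars p 0).val, (J.vars p 1).val, (J.vars p 2).val))

/-- The NPN datum of a table byte: `(class, permutation index, input mask, output negation)`. -/
def npnB (T : Fin 8 → Bool) : ℕ × ℕ × ℕ × Bool :=
  npnData (T 0) (T 1) (T 2) (T 3) (T 4) (T 5) (T 6) (T 7)

/-- The NPN class of a record. -/
def clsOf (r : Rec) : ℕ := (npnB r.1).1

/-- The output negation of a record. -/
def negOf (r : Rec) : Bool := (npnB r.1).2.2.2

/-- The bucket of class `c`: the records of that class, with their output indices. -/
def bucket (recs : List Rec) (c : ℕ) : List (ℕ × Rec) :=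
  ((List.range recs.length).zip recs).filter fun q => decide (clsOf q.2 = c)

/-- The three variables of a record, by role. -/
def selVar (r : Rec) : Fin 3 → ℕ := ![r.2.1, r.2.2.1, r.2.2.2]

/-- One variable of the relaxed pure output of a record: the copy `6v + 2r + s`. -/
def pureVar (r : Rec) (i : Fin 3) : ℕ :=
  6 * selVar r (perm (npnB r.1).2.1 i) + (2 * i.val + if maskBit (npnB r.1).2.2.1 i then 1 else 0)

/-- The variable triple of the relaxed pure output of a record. -/
def pureTriple (r : Rec) : ℕ × ℕ × ℕ := (pureVar r 0, pureVar r 1, pureVar r 2)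

/-- The raw relaxed bucket of class `c`: `6n` variables, one pure output per bucket record. -/
def pureOf (ri : RI) (c : ℕ) : PRaw :=
  (6 * ri.1, (bucket ri.2.2 c).length, (bucket ri.2.2 c).map fun q => pureTriple q.2)

/-- Looking up the bit of output `j` in a keyed list (default `false`). -/
def lookupBit (A : List ((ℕ × Rec) × Bool)) (j : ℕ) : Bool :=
  match A.find? fun t => decide (t.1.1 = j) with
  | none => false
  | some t => t.2

/-- Scattering a bucket pattern `y'` over all outputs: bucket output `j` at bucket position `p`
gets `y'_p ⊕ neg_j`, the others their negation bit (any value would do). -/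
def scatter (recs : List Rec) (c : ℕ) (y' : List Bool) : List Bool :=
  (List.range recs.length).map fun j =>
    xor (lookupBit ((bucket recs c).zip y') j) (negOf (recs.getD j default))

/-! ## Agreement with the mathematical objects -/

section Math

variable {n m : ℕ} (I : LocalMap 3 n m) (c : ℕ)

/-- The NPN datum of a record is the NPN datum of the output's table. -/
theorem npnB_recOf (j : Fin m) : npnB (recOf I j).1 = npnOf (I.table j) := rfl

/-- The variables of a record are the output's variables. -/
theorem selVar_recOf (j : Fin m) (i : Fin 3) : selVar (recOf I j) i = (I.vars j i).val := by
  fin_cases i <;> rfl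

/-- The record list of an instance has length `m`. -/
theorem length_recs : (List.ofFn (recOf I)).length = m := List.length_ofFn

/-- Members of the bucket are (index, record) pairs of the instance, of class `c`. -/
theorem mem_bucket {q : ℕ × Rec} (hq : q ∈ bucket (List.ofFn (recOf I)) c) :
    ∃ h : q.1 < m, q.2 = recOf I ⟨q.1, h⟩ ∧ (npnOf (I.table ⟨q.1, h⟩)).1 = c := by
  unfold bucket at hq
  rw [List.mem_filter] at hq
  obtain ⟨hz, hc⟩ := hq
  obtain ⟨i, hi, hget⟩ := List.getElem_of_mem hz
  rw [List.getElem_zip] at hget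
  have hi' : i < m := by
    rw [List.length_zip, List.length_range, List.length_ofFn] at hi; omega
  have h1 : q.1 = i := by rw [← hget]; simp
  have h2 : q.2 = recOf I ⟨i, hi'⟩ := by rw [← hget]; simp
  subst h1
  refine ⟨hi', h2, ?_⟩
  have hc' := of_decide_eq_true hc
  rw [h2] at hc'
  exact hc'

/-- The bucket's indices are strictly increasing. -/
theorem bucket_pairwise : (bucket (List.ofFn (recOf I)) c).Pairwise fun q q' => q.1 < q'.1 := by
  unfold bucket
  refine List.Pairwise.filter _ ?_
  have hz : (((List.range (List.ofFn (recOf I)).length).zip (List.ofFn (recOf I))).map Prod.fst) =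
      List.range (List.ofFn (recOf I)).length := List.map_fst_zip (by simp)
  have h := List.pairwise_lt_range (n := (List.ofFn (recOf I)).length)
  rw [← hz, List.pairwise_map] at h
  exact h

/-- The number of outputs of the relaxed bucket. -/
def Mb : ℕ := (bucket (List.ofFn (recOf I)) c).length

/-- The bucket entry at a position. -/
def bAt (p : Fin (Mb I c)) : ℕ × Rec := (bucket (List.ofFn (recOf I)) c)[p.val]'p.isLt

/-- The bucket entry at a position is a member of the bucket. -/
theorem bAt_mem (p : Fin (Mb I c)) : bAt I c p ∈ bucket (List.ofFn (recOf I)) c :=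
  List.getElem_mem _

/-- The output index of a bucket position. -/
def ιb (p : Fin (Mb I c)) : Fin m := ⟨(bAt I c p).1, (mem_bucket I c (bAt_mem I c p)).1⟩

/-- The record at a bucket position is the record of its output. -/
theorem bAt_snd (p : Fin (Mb I c)) : (bAt I c p).2 = recOf I (ιb I c p) :=
  (mem_bucket I c (bAt_mem I c p)).2.1

/-- Bucket outputs have class `c`. -/
theorem cls_ιb (p : Fin (Mb I c)) : (npnOf (I.table (ιb I c p))).1 = c :=
  (mem_bucket I c (bAt_mem I c p)).2.2

/-- The output indices of distinct bucket positions increase. -/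
theorem ιb_lt {p p' : Fin (Mb I c)} (h : p < p') : (ιb I c p).val < (ιb I c p').val := by
  have hp := List.pairwise_iff_getElem.1 (bucket_pairwise I c) p.val p'.val p.isLt p'.isLt h
  exact hp

/-- The output index map of the bucket is injective. -/
theorem ιb_injective : Function.Injective (ιb I c) := by
  intro p p' h
  rcases lt_trichotomy p p' with hlt | heq | hgt
  · exact absurd (congrArg Fin.val h) (Nat.ne_of_lt (ιb_lt I c hlt))
  · exact heq
  · exact absurd (congrArg Fin.val h).symm (Nat.ne_of_lt (ιb_lt I c hgt))

/-- The input permutation of a bucket output. -/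
def πb (p : Fin (Mb I c)) (r : Fin 3) : Fin 3 := perm (npnOf (I.table (ιb I c p))).2.1 r

/-- The input mask of a bucket output. -/
def σb (p : Fin (Mb I c)) (r : Fin 3) : Bool := maskBit (npnOf (I.table (ιb I c p))).2.2.1 r

/-- The output negation of a bucket output. -/
def bb (p : Fin (Mb I c)) : Bool := (npnOf (I.table (ιb I c p))).2.2.2

/-- **The relaxed bucket**: a pure instance of class `c` on the `6n` variable copies. -/
def Jb : LocalMap 3 (6 * n) (Mb I c) := relax (restrict I (ιb I c)) (πb I c) (σb I c) (rep c)

/-- The relaxed bucket is pure of class `c`. -/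
theorem Jb_isPure : (Jb I c).IsPure (rep c) := relax_isPure _ _ _ _

/-- Tables of bucket outputs in NPN normal form around `rep c`. -/
theorem table_ιb (p : Fin (Mb I c)) (u : Fin 3 → Bool) :
    I.table (ιb I c p) u = xor (rep c (fun r => xor (u (πb I c p r)) (σb I c p r))) (bb I c p) := by
  have h := npn_normal_form (I.table (ιb I c p)) u
  rw [cls_ιb] at h
  exact h

/-- **The program's raw relaxed bucket is the raw form of the relaxed bucket.** -/
theorem rawOf_Jb : rawOf (Jb I c) = pureOf (toRaw ⟨n, m, I⟩) c := by
  unfold rawOf pureOf toRaw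
  simp only
  refine Prod.ext rfl (Prod.ext rfl ?_)
  apply List.ext_getElem
  · simp [Mb]
  · intro p h1 h2
    have hp : p < Mb I c := by simpa using h1
    rw [List.getElem_ofFn, List.getElem_map]
    have key : pureTriple (bAt I c ⟨p, hp⟩).2 =
        (((Jb I c).vars ⟨p, hp⟩ 0).val, ((Jb I c).vars ⟨p, hp⟩ 1).val, ((Jb I c).vars ⟨p, hp⟩ 2).val) := by
      rw [bAt_snd]
      simp only [pureTriple, pureVar, npnB_recOf, selVar_recOf, Jb, relax, restrict, cp_val, πb, σb,
        Fin.val_zero, Fin.val_one, Fin.val_two, mul_zero, mul_one, zero_add]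
      rfl
    exact key.symm

/-! ## Scatter -/

/-- In a keyed list with strictly increasing keys zipped with values, the lookup of the `p`-th key
returns the `p`-th value. -/
theorem lookupBit_zip {B : List (ℕ × Rec)} (hB : B.Pairwise fun q q' => q.1 < q'.1) {y' : List Bool}
    {p : ℕ} (hp : p < B.length) (hpy : p < y'.length) :
    lookupBit (B.zip y') (B[p].1) = y'[p] := by
  unfold lookupBit
  have hz : p < (B.zip y').length := by rw [List.length_zip]; exact lt_min hp hpy
  have hfind : (B.zip y').find? (fun t => decide (t.1.1 = B[p].1)) = some (B[p], y'[p]) := by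
    rw [List.find?_eq_some_iff_getElem]
    refine ⟨by simp, p, hz, by rw [List.getElem_zip], fun j hj => ?_⟩
    rw [List.getElem_zip, Bool.not_eq_true', decide_eq_false_iff_not]
    have hlt := List.pairwise_iff_getElem.1 hB j p (by omega) hp hj
    exact Nat.ne_of_lt hlt
  rw [hfind]

/-- The scattered list read at a bucket output. -/
theorem scatter_ιb {y' : List Bool} (hy' : y'.length = Mb I c) (p : Fin (Mb I c)) :
    (scatter (List.ofFn (recOf I)) c y').getD (ιb I c p).val false = xor (y'.getD p.val false) (bb I c p) := by
  unfold scatter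
  rw [List.getD_eq_getElem?_getD, List.getElem?_map, List.getElem?_range (by
    rw [List.length_ofFn]; exact (ιb I c p).isLt)]
  simp only [Option.map_some, Option.getD_some]
  have h1 : lookupBit ((bucket (List.ofFn (recOf I)) c).zip y') (ιb I c p).val = y'.getD p.val false := by
    have h := lookupBit_zip (bucket_pairwise I c) (y' := y') (p := p.val) p.isLt (by rw [hy']; exact p.isLt)
    rw [List.getD_eq_getElem?_getD, List.getElem?_eq_getElem (by rw [hy']; exact p.isLt)]
    exact h
  have h2 : negOf ((List.ofFn (recOf I)).getD (ιb I c p).val default) = bb I c p := by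
    rw [List.getD_eq_getElem?_getD, List.getElem?_ofFn]
    simp [bb, negOf, npnB_recOf, (ιb I c p).isLt]
  rw [h1, h2]

/-- **Glue theorem.** A list of length `M'` which, read as a pattern, avoids the range of the
relaxed bucket, scatters to a list which, read as a pattern, avoids the range of the instance. -/
theorem scatter_not_mem {y' : List Bool} (hy' : y'.length = Mb I c)
    (hJ : (fun p : Fin (Mb I c) => y'.getD p.val false) ∉ (Jb I c).range) :
    (fun j : Fin m => (scatter (List.ofFn (recOf I)) c y').getD j.val false) ∉ I.range :=
  not_mem_range_of_bucket I (ιb I c) (ιb_injective I c) (πb I c) (σb I c) (bb I c) (rep c)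
    (table_ιb I c) hJ _ (fun p => scatter_ιb I c hy' p)

/-- The scattered list has length `m`. -/
theorem length_scatter (recs : List Rec) (c : ℕ) (y' : List Bool) :
    (scatter recs c y').length = recs.length := by
  simp [scatter]

end Math

end Summit.PneNP.PneNP.Theorems.Nc03Reduction
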